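import Summits.KontsevichZagierPeriods.KontsevichZagierPeriods.Theses.OctahedralSymmetry

/-!
# `OctahedralInvolutionMove` (stmt-KontsevichZagierPeriods-9435, route OctahedralSymmetry) — line `Sketch`

The crux: Zhao's octahedral involution `σ : e₀ ↔ e₁, e_i ↔ e_{−i}, e_{−1} ↔ e_∞` of
`ℙ¹ ∖ {0, ∞, ±1, ±i}` [Zhao 2008, arXiv:0810.1064, §4] is the self-map `u ↦ (1 − u)/(1 + u)` of
`[0, 1]`; on the open ordered simplex `Δ_w = {1 > t₀ > ⋯ > t_{w−1} > 0}` the map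
`Φ(t)_j = σ(t_{w−1−j})` is a `ℚ`-semialgebraic bijection `Δ_w → Δ_w` with `|det Φ′(t)| = ∏_j 2/(1+t_j)²`,
so for representations `r, r′` of the Kontsevich–Zagier calculus on `Δ_w` with
`r.integrand t = r′.integrand (Φ t) · ∏_j 2/(1+t_j)²` the difference `[r] − [r′]` is ONE generator of
`KZ.changeOfVariablesRel` (rule (2) of [Kontsevich–Zagier 2001, §1.2]).

Proof (direct witness, with the matrix packaging of the tree twin `FurushoPentagon.DualityInKZ`).
The witness `Φ` is the map printed in the statement. Its derivative at `t` is packaged as the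
continuous linear map of the MATRIX `(diagonal (σ′ ∘ t)).submatrix rev id`, `σ′(u) = −2/(1+u)²`,
so that `|det Φ′(t)| = |det diagonal (σ′ ∘ t)| = ∏_k |σ′(t_k)| = ∏_k 2/(1+t_k)²` by
`Matrix.abs_det_submatrix_equiv_equiv` and `Matrix.det_diagonal` — the sign of the order-reversing
permutation never appears. Injectivity on `Δ_w` and the EXACT image `Φ '' Δ_w = Δ_w` come at once
from `Set.InvOn.bijOn` fed with the involution identity `Φ (Φ t) = t` (`σ (σ u) = u` off the pole
`u = −1`) and `MapsTo Φ Δ_w Δ_w` (`σ` is a decreasing self-map of `(0, 1)` and `Fin.rev` restores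
`StrictAnti`). Tameness is `isSemialgebraicFunOn_aeval_div_aeval` coordinatewise (coordinate `j` is
the rational function `(1 − X_{rev j})/(1 + X_{rev j})` with rational coefficients, denominator
`> 0` on `Δ_w`) assembled by `IsSemialgebraicMapOn.of_forall`; no Tarski–Seidenberg fact is used.
The case `w = 0` is uniform (one-point space, `Φ = id`, empty product, `0 × 0` determinant).

## References

* J. Zhao, *Multiple polylogarithm values at roots of unity*, C. R. Acad. Sci. Paris 346 (2008),
  arXiv:0810.1064, §4 (the octahedral involution `σ`).
* M. Kontsevich, D. Zagier, *Periods* (2001), §1.2, rule (2).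
* J. Bochnak, M. Coste, M.-F. Roy, *Real Algebraic Geometry* (1998), Def. 2.2.5, §2.2.
-/

noncomputable section

open MeasureTheory Set MvPolynomial
open Literature.NumberTheory.Transcendental Literature.NumberTheory.Transcendental.KZ

namespace Summit.KontsevichZagierPeriods.OctahedralSymmetry.OctahedralInvolutionMove

open Summit.KontsevichZagierPeriods.KontsevichZagierPeriods.Theses.OctahedralSymmetry
  (OctahedralInvolutionMove)

/-! ### One variable: Zhao's involution `σ(u) = (1 − u)/(1 + u)` -/

/-- Zhao's involution `σ(u) = (1 − u)/(1 + u)` has derivative `σ′(u) = −2/(1 + u)²` at every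
`u ≠ −1`. [Zhao 2008, §4; folklore] -/
theorem hasDerivAt_cay {u : ℝ} (hu : 1 + u ≠ 0) :
    HasDerivAt (fun x : ℝ => (1 - x) / (1 + x)) (-2 / (1 + u) ^ 2) u := by
  have h1 : HasDerivAt (fun x : ℝ => 1 - x) (-1) u := by
    simpa using (hasDerivAt_id u).const_sub (1 : ℝ)
  have h2 : HasDerivAt (fun x : ℝ => 1 + x) 1 u := by
    simpa using (hasDerivAt_id u).const_add (1 : ℝ)
  have h := h1.fun_div h2 hu
  have hval : (-1 * (1 + u) - (1 - u) * 1) / (1 + u) ^ 2 = -2 / (1 + u) ^ 2 := by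
    congr 1
    ring
  rw [hval] at h
  exact h

/-- `|σ′(u)| = |−2/(1 + u)²| = 2/(1 + u)²`. [folklore] -/
theorem abs_cayDeriv (u : ℝ) : |(-2 / (1 + u) ^ 2 : ℝ)| = 2 / (1 + u) ^ 2 := by
  rw [abs_div, abs_neg, abs_two, abs_of_nonneg (sq_nonneg _)]

/-- `σ` is an involution off its pole: `σ (σ u) = u` for `u ≠ −1`
(`1 − σ(u) = 2u/(1 + u)` and `1 + σ(u) = 2/(1 + u)`). [Zhao 2008, §4] -/
theorem cay_cay {u : ℝ} (hu : 1 + u ≠ 0) :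
    (1 - (1 - u) / (1 + u)) / (1 + (1 - u) / (1 + u)) = u := by
  have hsub : 1 - (1 - u) / (1 + u) = 2 * u / (1 + u) := by
    field_simp
    ring
  have hadd : 1 + (1 - u) / (1 + u) = 2 / (1 + u) := by
    field_simp
    ring
  rw [hsub, hadd]
  have h2 : (2 : ℝ) ≠ 0 := two_ne_zero
  field_simp

/-- `σ` is positive on `(−1, 1)`. [folklore] -/
theorem cay_pos {u : ℝ} (h0 : -1 < u) (h1 : u < 1) : 0 < (1 - u) / (1 + u) :=
  div_pos (by linarith) (by linarith)

/-- `σ(u) < 1` for `u > 0`. [folklore] -/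
theorem cay_lt_one {u : ℝ} (h0 : 0 < u) : (1 - u) / (1 + u) < 1 := by
  rw [div_lt_one (by linarith)]
  linarith

/-- `σ` is strictly decreasing on `(−1, ∞)`. [folklore] -/
theorem cay_lt_cay {u v : ℝ} (hu : -1 < u) (huv : u < v) :
    (1 - v) / (1 + v) < (1 - u) / (1 + u) := by
  have hu' : (0 : ℝ) < 1 + u := by linarith
  have hv' : (0 : ℝ) < 1 + v := by linarith
  -- `σ(x) = 2/(1 + x) − 1` off the pole
  have hform : ∀ x : ℝ, 1 + x ≠ 0 → (1 - x) / (1 + x) = 2 / (1 + x) - 1 := by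
    intro x hx
    field_simp
    ring
  rw [hform v hv'.ne', hform u hu'.ne']
  have : 2 / (1 + v) < 2 / (1 + u) := div_lt_div_of_pos_left two_pos hu' (by linarith)
  linarith

/-! ### The map `Φ(t)_j = σ(t_{w−1−j})` on `ℝ^w` and its Jacobian

`Φ` is written, as in the crux, as the lambda `fun t j => (1 - t (Fin.rev j)) / (1 + t (Fin.rev j))`;
its derivative at `t` is the continuous linear map of the matrix
`(Matrix.diagonal fun k => -2 / (1 + t k) ^ 2).submatrix ⇑Fin.revPerm ⇑(Equiv.refl _)`. -/

variable {w : ℕ}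

/-- The linear map of the Jacobian matrix acts by `v ↦ (σ′(t_{rev j}) · v_{rev j})_j`. [folklore] -/
theorem octDeriv_apply (t v : Fin w → ℝ) :
    Matrix.toLin' ((Matrix.diagonal fun k => -2 / (1 + t k) ^ 2).submatrix
      (Fin.revPerm : Fin w ≃ Fin w) (Equiv.refl (Fin w))) v =
      fun j => -2 / (1 + t (Fin.rev j)) ^ 2 * v (Fin.rev j) := by
  rw [Matrix.toLin'_apply, Matrix.submatrix_mulVec_equiv]
  ext j
  simp [Matrix.mulVec_diagonal]

/-- **The Jacobian.** `|det Φ′(t)| = ∏_k 2/(1 + t_k)²`: the permutation sign is killed by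
`Matrix.abs_det_submatrix_equiv_equiv`, and the diagonal determinant is `∏ σ′(t_k)`. [folklore] -/
theorem abs_det_octDeriv (t : Fin w → ℝ) :
    |(LinearMap.toContinuousLinearMap (Matrix.toLin'
      ((Matrix.diagonal fun k => -2 / (1 + t k) ^ 2).submatrix (Fin.revPerm : Fin w ≃ Fin w)
        (Equiv.refl (Fin w))))).det| = ∏ k, 2 / (1 + t k) ^ 2 := by
  change |LinearMap.det (Matrix.toLin' ((Matrix.diagonal fun k => -2 / (1 + t k) ^ 2).submatrix
    (Fin.revPerm : Fin w ≃ Fin w) (Equiv.refl (Fin w))))| = _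
  rw [LinearMap.det_toLin', Matrix.abs_det_submatrix_equiv_equiv, Matrix.det_diagonal,
    Finset.abs_prod]
  exact Finset.prod_congr rfl fun k _ => abs_cayDeriv (t k)

/-- `Φ` is differentiable, with derivative the linear map of the Jacobian matrix, at every point
none of whose coordinates is `−1`. [folklore] -/
theorem hasFDerivAt_octMap {t : Fin w → ℝ} (ht : ∀ k, 1 + t k ≠ 0) :
    HasFDerivAt (fun (x : Fin w → ℝ) (j : Fin w) => (1 - x (Fin.rev j)) / (1 + x (Fin.rev j)))
      (LinearMap.toContinuousLinearMap (Matrix.toLin'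
        ((Matrix.diagonal fun k => -2 / (1 + t k) ^ 2).submatrix (Fin.revPerm : Fin w ≃ Fin w)
          (Equiv.refl (Fin w))))) t := by
  rw [hasFDerivAt_pi']
  intro j
  have h : HasFDerivAt (fun x : Fin w → ℝ => (1 - x (Fin.rev j)) / (1 + x (Fin.rev j)))
      ((-2 / (1 + t (Fin.rev j)) ^ 2) • ContinuousLinearMap.proj (R := ℝ) (φ := fun _ : Fin w => ℝ)
        (Fin.rev j)) t :=
    HasDerivAt.comp_hasFDerivAt t (hasDerivAt_cay (ht (Fin.rev j)))
      (hasFDerivAt_apply (Fin.rev j) t)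
  have hL : (ContinuousLinearMap.proj j).comp (LinearMap.toContinuousLinearMap (Matrix.toLin'
      ((Matrix.diagonal fun k => -2 / (1 + t k) ^ 2).submatrix (Fin.revPerm : Fin w ≃ Fin w)
        (Equiv.refl (Fin w))))) =
      (-2 / (1 + t (Fin.rev j)) ^ 2) • ContinuousLinearMap.proj (R := ℝ) (φ := fun _ : Fin w => ℝ)
        (Fin.rev j) := by
    ext v
    change Matrix.toLin' ((Matrix.diagonal fun k => -2 / (1 + t k) ^ 2).submatrix
      (Fin.revPerm : Fin w ≃ Fin w) (Equiv.refl (Fin w))) v j = _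
    rw [octDeriv_apply]
    simp
  rw [hL]
  exact h

/-- `Φ` is an involution off the poles: `Φ (Φ t) = t` whenever no coordinate of `t` is `−1`.
[Zhao 2008, §4] -/
theorem octMap_octMap {t : Fin w → ℝ} (ht : ∀ k, 1 + t k ≠ 0) :
    (fun j : Fin w => (1 - (fun i : Fin w => (1 - t (Fin.rev i)) / (1 + t (Fin.rev i))) (Fin.rev j)) /
      (1 + (fun i : Fin w => (1 - t (Fin.rev i)) / (1 + t (Fin.rev i))) (Fin.rev j))) = t := by
  ext j
  simp only [Fin.rev_rev]
  exact cay_cay (ht j)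

/-- On the open ordered simplex no coordinate is `−1` (indeed `1 + t_k > 0`). [folklore] -/
theorem one_add_ne_zero_of_mem_simplex {t : Fin w → ℝ}
    (ht : t ∈ {t : Fin w → ℝ | (∀ i, 0 < t i) ∧ (∀ i, t i < 1) ∧ StrictAnti t}) (k : Fin w) :
    1 + t k ≠ 0 :=
  (add_pos one_pos (ht.1 k)).ne'

/-- `Φ` maps the open ordered simplex into itself: `σ` is a decreasing self-map of `(0, 1)` and the
order reversal `rev` restores strict antitonicity. [Zhao 2008, §4] -/
theorem mapsTo_octMap :
    MapsTo (fun (t : Fin w → ℝ) (j : Fin w) => (1 - t (Fin.rev j)) / (1 + t (Fin.rev j)))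
      {t | (∀ i, 0 < t i) ∧ (∀ i, t i < 1) ∧ StrictAnti t}
      {t | (∀ i, 0 < t i) ∧ (∀ i, t i < 1) ∧ StrictAnti t} := by
  intro t ht
  obtain ⟨h0, h1, hanti⟩ := ht
  refine ⟨fun j => ?_, fun j => ?_, fun i j hij => ?_⟩
  · exact cay_pos (by linarith [h0 (Fin.rev j)]) (h1 _)
  · exact cay_lt_one (h0 _)
  · have hlt : t (Fin.rev i) < t (Fin.rev j) := hanti (Fin.rev_lt_rev.2 hij)
    exact cay_lt_cay (by linarith [h0 (Fin.rev i)]) hlt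

/-- `Φ` is a bijection of the open ordered simplex onto itself (an involution mapping the simplex
into itself). [Zhao 2008, §4] -/
theorem bijOn_octMap :
    BijOn (fun (t : Fin w → ℝ) (j : Fin w) => (1 - t (Fin.rev j)) / (1 + t (Fin.rev j)))
      {t | (∀ i, 0 < t i) ∧ (∀ i, t i < 1) ∧ StrictAnti t}
      {t | (∀ i, 0 < t i) ∧ (∀ i, t i < 1) ∧ StrictAnti t} := by
  refine Set.InvOn.bijOn ⟨fun t ht => ?_, fun t ht => ?_⟩ mapsTo_octMap mapsTo_octMap
  · exact octMap_octMap (one_add_ne_zero_of_mem_simplex ht)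
  · exact octMap_octMap (one_add_ne_zero_of_mem_simplex ht)

/-- **Tameness.** `Φ` is a `ℚ`-semialgebraic map on every `ℚ`-semialgebraic set avoiding the
poles: coordinate `j` is the rational function `(1 − X_{rev j})/(1 + X_{rev j})` with rational
coefficients and non-vanishing denominator (graph cut out by polynomial equations; no
Tarski–Seidenberg). [BCR 1998, §2.2] -/
theorem isSemialgebraicMapOn_octMap {s : Set (Fin w → ℝ)}
    (hs : Literature.ModelTheory.ExponentialFields.IsSemialgebraic ℚ s)
    (hpos : ∀ t ∈ s, ∀ k, 1 + t k ≠ 0) :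
    IsSemialgebraicMapOn ℚ s
      (fun (t : Fin w → ℝ) (j : Fin w) => (1 - t (Fin.rev j)) / (1 + t (Fin.rev j))) := by
  refine IsSemialgebraicMapOn.of_forall hs fun j => ?_
  have hq : ∀ x ∈ s, aeval x (1 + X (Fin.rev j) : MvPolynomial (Fin w) ℚ) ≠ 0 := by
    intro x hx
    simpa using hpos x hx (Fin.rev j)
  refine (isSemialgebraicFunOn_aeval_div_aeval hs (1 - X (Fin.rev j) : MvPolynomial (Fin w) ℚ)
    (1 + X (Fin.rev j)) hq).congr ?_
  intro x _
  simp

/-! ### The crux -/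

/-- **Zhao's octahedral involution is ONE change-of-variables move** (crux
`OctahedralInvolutionMove`, stmt-KontsevichZagierPeriods-9435). For every `w` and representations
`r, r′` on the open ordered simplex `Δ_w` with `r.integrand t = r′.integrand (Φ t) · ∏_j 2/(1+t_j)²`
on `Δ_w`, where `Φ(t)_j = (1 − t_{w−1−j})/(1 + t_{w−1−j})`, the element `[r] − [r′]` lies in
`KZ.changeOfVariablesRel` — witness `Φ` (as printed) with `Φ′(t)` the linear map of
`(diagonal (−2/(1+t_k)²)_k).submatrix rev id`: semialgebraic (`isSemialgebraicMapOn_octMap`),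
differentiable (`hasFDerivAt_octMap`), injective with image exactly `Δ_w` (`bijOn_octMap`),
Jacobian `|det Φ′(t)| = ∏ 2/(1+t_j)²` (`abs_det_octDeriv`).
[Zhao 2008, §4; Kontsevich–Zagier 2001, §1.2, rule (2)] -/
theorem OctahedralInvolutionMove_of : OctahedralInvolutionMove := by
  intro w r r' hr hr' hint
  have hpos : ∀ t ∈ r.domain, ∀ k, 1 + t k ≠ 0 := by
    intro t ht
    rw [hr] at ht
    exact one_add_ne_zero_of_mem_simplex ht
  refine ⟨w, r, r', fun t j => (1 - t (Fin.rev j)) / (1 + t (Fin.rev j)),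
    fun t => LinearMap.toContinuousLinearMap (Matrix.toLin'
      ((Matrix.diagonal fun k => -2 / (1 + t k) ^ 2).submatrix (Fin.revPerm : Fin w ≃ Fin w)
        (Equiv.refl (Fin w)))),
    isSemialgebraicMapOn_octMap r.isSemialgebraic_domain hpos,
    fun t ht => (hasFDerivAt_octMap (hpos t ht)).hasFDerivWithinAt, ?_, ?_, ?_, rfl⟩
  · rw [hr]
    exact bijOn_octMap.injOn
  · rw [hr', hr]
    exact bijOn_octMap.image_eq.symm
  · intro t ht
    rw [hint t ht, abs_det_octDeriv]

end Summit.KontsevichZagierPeriods.OctahedralSymmetry.OctahedralInvolutionMove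

end
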